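import Summits.CriticalPhenomena.CardyFormulaZ2.Theses.CardyBoundaryCoulombGas
import Summits.CriticalPhenomena.CardyFormulaZ2.Theorems.CardyBoundaryCoulombGasRectilinearCardyClosureDefs
import Summits.CriticalPhenomena.CardyFormulaZ2.Theorems.RectilinearCardy.Negative.RectilinearCardyReductions
import Summits.CriticalPhenomena.CardyFormulaZ2.Theorems.CardyBoundaryCoulombGasRectilinearCardyStubChartAlgebra
import Summits.CriticalPhenomena.CardyFormulaZ2.Theorems.CardyBoundaryCoulombGasRectilinearCardyStubReverseInsert
import Literature.Probability.LatticeModels.CollarLegModelRainbow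
import HarnessLib

/-!
# Stub A2′ of line excursion-kernel-covariance (crux RectilinearCardy, stmt-CriticalPhenomena-5660), Part 1: the CLOCKWISE core `pointwise_cw`

Lead `prover-line-stmt-CriticalPhenomena-5660-c3-0`, reshape c3-1 of the skeleton
`Cruxes/RectilinearCardy/Lines/excursion_kernel_covariance.lean`. The registered stub
`stub_pointwiseFromEngineG : BoundaryDefectGaussianR → LatticeBridge → PointwiseDensityLawG` (all
inlined): the route's engine crux (stmt-14132) and the line's lattice bridge (the Baxter–Kelland–Wu
dictionary in use: placements of the `(1,3,1,1; sink 1)` datum along the boundary row of the closure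
polygon whose insertion ratio `‖Zins‖/‖Z‖` is the closure density up to `o(δ)`) give the POINTWISE
CLOSURE-DENSITY LAW for charts of the Schwarz class: `closureDensity R δ_n v_n / δ_n → C Φ_w(x)` along
boundary-row vertices `δ_n v_n → x = ∂Ω(τ)`, `Φ_w(x) = |w′(x)| (∏_{p=a,b,d} |w(x) - w(p)|²)^{-1/3}`.

Proof (composition of the landed analytic stubs of wave 1):
* `stub_orientation` decides the orientation of the boundary loop at the flat mark `a` and matches it
  with the monotonicity of the chart's boundary function `g` (`Re (w′ u) ≥ 0` on the left);
* CLOCKWISE (`pointwise_cw`): the engine's `(1,3,1,1; 1)` member (charges `(1,-2,1,1)`, `Σ h = 1`) is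
  applied to the REVERSED mark-inserted marked domain `(Ω; d, ∂Ω(τ), b, a)` (`stub_reverseInsert`),
  which is counter-clockwise, so the chart's boundary values increase along it near every mark
  (`strictMonoOn_re_reversed`); the bridge's placements are shifted to be injective and admissible
  from the start; the engine's limit is read through `stub_chartAlgebra` ((b): closed form
  `C₀ K Φ_w(x)`, `K = (|w d - w b| |w d - w a| |w b - w a|)^{1/3}`; (c): normalisation `δ⁻¹`), and the
  bridge's `o(δ)` comparison transfers it to `closureDensity / δ`;
* COUNTER-CLOCKWISE: the configuration is reflected by complex conjugation — the conjugate copy `R'`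
  (`stub_conjGeometry`: rectilinear, flat marks, admissible windows, boundary row, now clockwise at
  `a`) with the conjugate chart `z ↦ -conj (w (conj z))` (`stub_chartAlgebra` (a)), whose boundary
  function `-g` decreases; `pointwise_cw` applies to it, and the conclusion is carried back by the
  reflection-invariance of the closure density (`stub_conjDensity`) and of the profile
  (`‖deriv‖`, `‖w x - w p‖` are conjugation-invariant).
Sources: Baxter–Kelland–Wu 1976 §3–4 (collar / leg insertions); the line card
`Cruxes/RectilinearCardy/Lines/excursion-kernel-covariance.md`; lead notes `Cruxes/RectilinearCardy/PICKED.md` (c3).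
-/

noncomputable section

open Set Filter Topology MeasureTheory Metric
open Literature.Probability.RandomPlanarGeometry
open Literature.Probability.LatticeModels (Site meshPoint zdGraph)
open Summit.CriticalPhenomena.CardyFormulaZ2.Theorems.RectilinearCardy.Negative (IsRectilinear)
open Summit.CriticalPhenomena.CardyFormulaZ2.Theses.CardyBoundaryCoulombGas (BoundaryDefectGaussianR)
open Literature.Probability.LatticeModels.CollarLegModel (LegInsertionData Zins ofDomain)

namespace Summit.CriticalPhenomena.CardyFormulaZ2.Cruxes.RectilinearCardy.ExcursionKernelCovariance

/-! ### Bookkeeping lemmas -/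

/-- `meshPoint δ x` in the engine's coordinates `x₀ δ + x₁ δ i`. [folklore] -/
theorem meshPoint_eq_pair (δ : ℝ) (x : Site 2) :
    meshPoint δ x = ((x 0 : ℤ) : ℂ) * δ + ((x 1 : ℤ) : ℂ) * δ * Complex.I := by
  apply Complex.ext <;> simp [Literature.Probability.LatticeModels.meshPoint_re,
    Literature.Probability.LatticeModels.meshPoint_im, mul_comm]

/-- Membership in the closure polygon read in `ℤ × ℤ`: the engine's `V`-hypothesis for
`V n = (closureFinset R δ_n).image (x ↦ (x₀, x₁))`. [folklore] -/
theorem mem_image_closureFinset_iff (R : ConformalRectangle) {δ : ℝ} (hδ : 0 < δ) (v : ℤ × ℤ) :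
    v ∈ (closureFinset R δ).image (fun x : Site 2 => (x 0, x 1)) ↔
      ((v.1 : ℂ) * δ + (v.2 : ℂ) * δ * Complex.I) ∈ closure R.carrier := by
  constructor
  · rintro h
    obtain ⟨x, hx, rfl⟩ := Finset.mem_image.1 h
    rw [mem_closureFinset_iff R hδ, meshPoint_eq_pair] at hx
    exact hx
  · intro h
    refine Finset.mem_image.2 ⟨![v.1, v.2], ?_, by simp⟩
    rw [mem_closureFinset_iff R hδ, meshPoint_eq_pair]
    simpa using h


/-! ### Local monotonicity of the reversed chart boundary values -/

/-- Near a parameter `s ∈ (S₀, S)` with `∂Ω(s) ∈ U`, if the chart's boundary function `g` is strictly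
antitone then `t ↦ Re w (∂Ω(c - t))` is strictly increasing near `c - s` (continuity of the loop keeps
`∂Ω(c - t)` inside `U`, where `w ∘ ∂Ω = g`). [folklore] -/
theorem strictMonoOn_re_reversed (R : ConformalRectangle) {U : Set ℂ} {w : ℂ → ℂ} (hUo : IsOpen U)
    {g : ℝ → ℝ} {S₀ S : ℝ} (hg : StrictAntiOn g (Icc S₀ S))
    (hwg : ∀ t ∈ Icc S₀ S, R.boundary t ∈ U → w (R.boundary t) = g t)
    (c : ℝ) {s : ℝ} (hs₀ : S₀ < s) (hs₁ : s < S) (hsU : R.boundary s ∈ U) :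
    ∃ ε : ℝ, 0 < ε ∧
      StrictMonoOn (fun t : ℝ => (w (R.boundary (c - t))).re) (Ioo ((c - s) - ε) ((c - s) + ε)) := by
  have hpre : {t : ℝ | R.boundary t ∈ U} ∈ 𝓝 s :=
    R.continuous_boundary.continuousAt.preimage_mem_nhds (hUo.mem_nhds hsU)
  obtain ⟨η, hη, hball⟩ := Metric.mem_nhds_iff.1 hpre
  refine ⟨min η (min (s - S₀) (S - s)), lt_min hη (lt_min (by linarith) (by linarith)), ?_⟩
  have hmin₁ : min η (min (s - S₀) (S - s)) ≤ η := min_le_left _ _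
  have hmin₂ : min η (min (s - S₀) (S - s)) ≤ s - S₀ := (min_le_right _ _).trans (min_le_left _ _)
  have hmin₃ : min η (min (s - S₀) (S - s)) ≤ S - s := (min_le_right _ _).trans (min_le_right _ _)
  -- the value at `t` is `g (c - t)` throughout the window
  have hval : ∀ t ∈ Ioo ((c - s) - min η (min (s - S₀) (S - s))) ((c - s) + min η (min (s - S₀) (S - s))),
      (w (R.boundary (c - t))).re = g (c - t) ∧ c - t ∈ Icc S₀ S := by
    intro t ht
    have hI : c - t ∈ Icc S₀ S := ⟨by linarith [ht.2], by linarith [ht.1]⟩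
    have hU : R.boundary (c - t) ∈ U := by
      apply hball
      rw [Metric.mem_ball, Real.dist_eq, abs_lt]
      constructor <;> linarith [ht.1, ht.2]
    rw [hwg _ hI hU, Complex.ofReal_re]
    exact ⟨rfl, hI⟩
  intro t₁ ht₁ t₂ ht₂ hlt
  obtain ⟨h₁, hI₁⟩ := hval t₁ ht₁
  obtain ⟨h₂, hI₂⟩ := hval t₂ ht₂
  simp only [h₁, h₂]
  exact hg hI₂ hI₁ (by linarith)

/-! ### The clockwise core: engine + bridge ⇒ pointwise law -/

/-- **Clockwise core.** For a CLOCKWISE rectilinear flat-marked `R` and a chart of the Schwarz class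
whose boundary function DEcreases, the engine's `(1,3,1,1; 1)` member on the reversed mark-inserted
domain `(Ω; d, ∂Ω(τ), b, a)` together with the lattice bridge gives the pointwise closure-density law
with constant `C₀ K`, `K = (|w d - w b| |w d - w a| |w b - w a|)^{1/3}`. [cite: BaxterKellandWu1976, §3–§4] -/
theorem pointwise_cw (hE : BoundaryDefectGaussianR)
    (hL :
      ∀ R : ConformalRectangle, IsRectilinear R → FlatMarks R →
        (∃ u : ℂ, (u = 1 ∨ u = Complex.I ∨ u = -1 ∨ u = -Complex.I) ∧ ∃ r : ℝ, 0 < r ∧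
          (∀ t t' : ℝ, R.mark 0 - r < t → t < t' → t' < R.mark 0 + r →
            0 < ((R.boundary t' - R.boundary t) / u).re ∧ ((R.boundary t' - R.boundary t) / u).im = 0) ∧
          (∀ z : ℂ, dist z (R.pt 0) < r →
            (z ∈ R.carrier ↔ 0 < -((z - R.pt 0) / u).im))) →
        ∀ σ σ' : ℝ, AdmissibleRange R σ σ' → ∀ τ ∈ Icc σ σ',
          ∀ (δ : ℕ → ℝ), (∀ n, 0 < δ n) → Tendsto δ atTop (𝓝 0) →
          ∀ (v : ℕ → Site 2), (∀ n, v n ∈ boundaryRow R (δ n)) →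
            Tendsto (fun n => meshPoint (δ n) (v n)) atTop (𝓝 (R.boundary τ)) →
            ∃ p : ℕ → Fin 4 → ℤ × ℤ,
              (∀ i : Fin 4, Tendsto (fun n => ((p n i).1 : ℂ) * δ n + ((p n i).2 : ℂ) * δ n * Complex.I)
                atTop (𝓝 ((![R.pt 3, R.boundary τ, R.pt 1, R.pt 0] : Fin 4 → ℂ) i))) ∧
              (∀ᶠ n in atTop, Function.Injective (p n) ∧
                LegInsertionData.IsAdmissible
                  (⟨(Finset.univ.erase 1).image (p n),
                    fun x ↦ ∑ i ∈ (Finset.univ.erase 1).filter (fun i ↦ p n i = x),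
                      (![1, 3, 1, 1] : Fin 4 → ℕ) i, p n 1⟩ : LegInsertionData)
                  ((closureFinset R (δ n)).image fun x : Site 2 => (x 0, x 1))) ∧
              ∀ ε : ℝ, 0 < ε → ∀ᶠ n in atTop,
                |‖Zins ((closureFinset R (δ n)).image fun x : Site 2 => (x 0, x 1))
                    (⟨(Finset.univ.erase 1).image (p n),
                      fun x ↦ ∑ i ∈ (Finset.univ.erase 1).filter (fun i ↦ p n i = x),
                        (![1, 3, 1, 1] : Fin 4 → ℕ) i, p n 1⟩ : LegInsertionData)‖ /
                    ‖(ofDomain ((closureFinset R (δ n)).image fun x : Site 2 => (x 0, x 1))).Z‖ -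
                  closureDensity R (δ n) (v n)| ≤ ε * δ n)
    (R : ConformalRectangle) (hR : IsRectilinear R) (hF : FlatMarks R)
    (hcw : ∃ u : ℂ, (u = 1 ∨ u = Complex.I ∨ u = -1 ∨ u = -Complex.I) ∧ ∃ r : ℝ, 0 < r ∧
        (∀ t t' : ℝ, R.mark 0 - r < t → t < t' → t' < R.mark 0 + r →
          0 < ((R.boundary t' - R.boundary t) / u).re ∧ ((R.boundary t' - R.boundary t) / u).im = 0) ∧
        (∀ z : ℂ, dist z (R.pt 0) < r → (z ∈ R.carrier ↔ 0 < -((z - R.pt 0) / u).im)))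
    (U : Set ℂ) (w : ℂ → ℂ) (hUo : IsOpen U) (hΩU : R.carrier ⊆ U)
    (h0U : R.pt 0 ∈ U) (h1U : R.pt 1 ∈ U) (h3U : R.pt 3 ∈ U)
    (hwd : DifferentiableOn ℂ w U) (hwbij : BijOn w R.carrier {z : ℂ | 0 < z.im})
    (g : ℝ → ℝ) (S₀ S : ℝ) (hS₀ : S₀ < 0) (h3S : R.mark 3 < S) (hg : StrictAntiOn g (Icc S₀ S))
    (hwg : ∀ t ∈ Icc S₀ S, R.boundary t ∈ U → w (R.boundary t) = g t) :
    ∃ C : ℝ, 0 < C ∧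
      ∀ σ σ' : ℝ, AdmissibleRange R σ σ' → R.boundary '' Icc σ σ' ⊆ U →
        (∀ τ ∈ Icc σ σ', w (R.boundary τ) ≠ w (R.pt 0) ∧ w (R.boundary τ) ≠ w (R.pt 1) ∧
          w (R.boundary τ) ≠ w (R.pt 3)) →
        ∀ τ ∈ Icc σ σ', ∀ (δ : ℕ → ℝ), (∀ n, 0 < δ n) → Tendsto δ atTop (𝓝 0) →
          ∀ (v : ℕ → Site 2), (∀ n, v n ∈ boundaryRow R (δ n)) →
            Tendsto (fun n => meshPoint (δ n) (v n)) atTop (𝓝 (R.boundary τ)) →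
            Tendsto (fun n => closureDensity R (δ n) (v n) / δ n) atTop
              (𝓝 (C * (‖deriv w (R.boundary τ)‖ *
                (‖w (R.boundary τ) - w (R.pt 0)‖ ^ 2 * ‖w (R.boundary τ) - w (R.pt 1)‖ ^ 2 *
                    ‖w (R.boundary τ) - w (R.pt 3)‖ ^ 2) ^ (-(1 / 3 : ℝ))))) := by
  -- the engine's `(1,3,1,1; 1)` member
  obtain ⟨C₀, hC₀, hEng⟩ := hE 4 ![1, 3, 1, 1] 1 (by decide)
  -- marks and their order
  have hm01 : R.mark 0 < R.mark 1 := R.strictMono_mark (show (0 : Fin 4) < 1 by decide)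
  have hm13 : R.mark 1 < R.mark 3 := R.strictMono_mark (show (1 : Fin 4) < 3 by decide)
  have hm0 : 0 ≤ R.mark 0 := (R.mark_mem 0).1
  have hm3 : R.mark 3 < 1 := (R.mark_mem 3).2
  -- the chart's values at the marks are `g (mark i)`
  have hw0 : w (R.pt 0) = g (R.mark 0) := hwg _ ⟨by linarith, by linarith⟩ h0U
  have hw1 : w (R.pt 1) = g (R.mark 1) := hwg _ ⟨by linarith, by linarith⟩ h1U
  have hw3 : w (R.pt 3) = g (R.mark 3) := hwg _ ⟨by linarith, by linarith⟩ h3U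
  -- the source constant `K > 0`
  set K : ℝ := (‖w (R.pt 3) - w (R.pt 1)‖ * ‖w (R.pt 3) - w (R.pt 0)‖ * ‖w (R.pt 1) - w (R.pt 0)‖) ^
    (1 / 3 : ℝ) with hK
  have hK0 : 0 < K := by
    have hI0 : R.mark 0 ∈ Icc S₀ S := ⟨by linarith, by linarith⟩
    have hI1 : R.mark 1 ∈ Icc S₀ S := ⟨by linarith, by linarith⟩
    have hI3 : R.mark 3 ∈ Icc S₀ S := ⟨by linarith, by linarith⟩
    have h31 : w (R.pt 3) ≠ w (R.pt 1) := by
      rw [hw3, hw1]; exact_mod_cast (hg hI1 hI3 hm13).ne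
    have h30 : w (R.pt 3) ≠ w (R.pt 0) := by
      rw [hw3, hw0]; exact_mod_cast (hg hI0 hI3 (hm01.trans hm13)).ne
    have h10 : w (R.pt 1) ≠ w (R.pt 0) := by
      rw [hw1, hw0]; exact_mod_cast (hg hI0 hI1 hm01).ne
    apply Real.rpow_pos_of_pos
    exact mul_pos (mul_pos (norm_pos_iff.2 (sub_ne_zero.2 h31)) (norm_pos_iff.2 (sub_ne_zero.2 h30)))
      (norm_pos_iff.2 (sub_ne_zero.2 h10))
  refine ⟨C₀ * K, mul_pos hC₀ hK0, ?_⟩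
  intro σ σ' hadm hwinU hsep τ hτ δ hδ hδ0 v hv hvx
  obtain ⟨h1σ, hσσ', hσ'3, rw, hrw, hflatwin⟩ := hadm
  have h1τ : R.mark 1 < τ := by linarith [hτ.1]
  have hτ3 : τ < R.mark 3 := by linarith [hτ.2]
  have hxU : R.boundary τ ∈ U := hwinU ⟨τ, hτ, rfl⟩
  obtain ⟨hx0, hx1, hx3⟩ := hsep τ hτ
  -- the reversed mark-inserted domain `(Ω; d, x, b, a)`
  obtain ⟨D, hDc, hDb, hDm⟩ := stub_reverseInsert R τ h1τ hτ3
  have hD0 : D.pt 0 = R.pt 3 := by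
    show D.boundary (D.mark 0) = R.boundary (R.mark 3)
    rw [hDb, hDm]; congr 1
    show R.mark 0 + R.mark 3 - R.mark 0 = R.mark 3; ring
  have hD1 : D.pt 1 = R.boundary τ := by
    show D.boundary (D.mark 1) = R.boundary τ
    rw [hDb, hDm]; congr 1
    show R.mark 0 + R.mark 3 - (R.mark 0 + R.mark 3 - τ) = τ; ring
  have hD2 : D.pt 2 = R.pt 1 := by
    show D.boundary (D.mark 2) = R.boundary (R.mark 1)
    rw [hDb, hDm]; congr 1
    show R.mark 0 + R.mark 3 - (R.mark 0 + R.mark 3 - R.mark 1) = R.mark 1; ring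
  have hD3 : D.pt 3 = R.pt 0 := by
    show D.boundary (D.mark 3) = R.boundary (R.mark 0)
    rw [hDb, hDm]; congr 1
    show R.mark 0 + R.mark 3 - R.mark 3 = R.mark 0; ring
  have hDpt : ∀ i, D.pt i = (![R.pt 3, R.boundary τ, R.pt 1, R.pt 0] : Fin 4 → ℂ) i := by
    intro i
    fin_cases i
    · exact hD0
    · exact hD1
    · exact hD2
    · exact hD3
  -- the engine's hypotheses for `D`
  have hErect : ∃ S : Finset (ℂ × ℂ), (∀ p ∈ S, p.1.re = p.2.re ∨ p.1.im = p.2.im) ∧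
      frontier D.carrier ⊆ ⋃ p ∈ S, segment ℝ p.1 p.2 := by
    rw [hDc]; exact hR
  have hEflat : ∀ i : Fin 4, ∃ r : ℝ, 0 < r ∧
      ((∀ z ∈ frontier D.carrier, dist z (D.pt i) < r → z.im = (D.pt i).im) ∨
        (∀ z ∈ frontier D.carrier, dist z (D.pt i) < r → z.re = (D.pt i).re)) := by
    intro i
    rw [hDc, hDpt i]
    fin_cases i
    · exact hF 3
    · exact ⟨rw, hrw, hflatwin τ hτ⟩
    · exact hF 1
    · exact hF 0
  have hEU : ∀ i : Fin 4, D.pt i ∈ U := by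
    intro i
    rw [hDpt i]
    fin_cases i
    · exact h3U
    · exact hxU
    · exact h1U
    · exact h0U
  have hEsub : D.carrier ⊆ U := by rw [hDc]; exact hΩU
  have hEbij : BijOn w D.carrier {z : ℂ | 0 < z.im} := by rw [hDc]; exact hwbij
  have hEmono : ∀ i : Fin 4, ∃ ε : ℝ, 0 < ε ∧
      StrictMonoOn (fun t : ℝ => (w (D.boundary t)).re) (Ioo (D.mark i - ε) (D.mark i + ε)) := by
    have key : ∀ (i : Fin 4) (s : ℝ), S₀ < s → s < S → R.boundary s ∈ U →
        D.mark i = R.mark 0 + R.mark 3 - s → ∃ ε : ℝ, 0 < ε ∧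
          StrictMonoOn (fun t : ℝ => (w (D.boundary t)).re) (Ioo (D.mark i - ε) (D.mark i + ε)) := by
      intro i s hs0 hs1 hsU hmi
      obtain ⟨ε, hε, hmono⟩ := strictMonoOn_re_reversed R hUo hg hwg (R.mark 0 + R.mark 3) hs0 hs1 hsU
      refine ⟨ε, hε, ?_⟩
      rw [hmi]
      simpa only [hDb] using hmono
    intro i
    fin_cases i
    · exact key 0 (R.mark 3) (by linarith) h3S h3U (by rw [hDm]; show R.mark 0 = _; ring)
    · exact key 1 τ (by linarith) (by linarith) hxU (by rw [hDm]; rfl)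
    · exact key 2 (R.mark 1) (by linarith) (by linarith) h1U (by rw [hDm]; rfl)
    · exact key 3 (R.mark 0) (by linarith) (by linarith) h0U (by rw [hDm]; show R.mark 3 = _; ring)
  -- the lattice bridge on `R` (clockwise), then shift the sequences to be admissible from the start
  obtain ⟨p, hpconv, hpev, hpo⟩ :=
    hL R hR hF hcw σ σ' ⟨h1σ, hσσ', hσ'3, rw, hrw, hflatwin⟩ τ hτ δ hδ hδ0 v hv hvx
  obtain ⟨N, hN⟩ := eventually_atTop.1 hpev
  set δ' : ℕ → ℝ := fun k => δ (k + N) with hδ'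
  set p' : ℕ → Fin 4 → ℤ × ℤ := fun k => p (k + N) with hp'
  set V' : ℕ → Finset (ℤ × ℤ) := fun k =>
    (closureFinset R (δ' k)).image (fun x : Site 2 => (x 0, x 1)) with hV'
  have hδ'pos : ∀ k, 0 < δ' k := fun k => hδ _
  have hδ'0 : Tendsto δ' atTop (𝓝 0) := hδ0.comp (tendsto_add_atTop_nat N)
  have hV'mem : ∀ (k : ℕ) (u : ℤ × ℤ), u ∈ V' k ↔
      ((u.1 : ℂ) * δ' k + (u.2 : ℂ) * δ' k * Complex.I) ∈ closure D.carrier := by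
    intro k u
    rw [hDc]
    exact mem_image_closureFinset_iff R (hδ'pos k) u
  have hp'inj : ∀ k, Function.Injective (p' k) := fun k => (hN (k + N) le_add_self).1
  have hp'adm : ∀ k, LegInsertionData.IsAdmissible
      (⟨(Finset.univ.erase 1).image (p' k),
        fun x ↦ ∑ i ∈ (Finset.univ.erase 1).filter (fun i ↦ p' k i = x),
          (![1, 3, 1, 1] : Fin 4 → ℕ) i, p' k 1⟩ : LegInsertionData) (V' k) :=
    fun k => (hN (k + N) le_add_self).2
  have hp'conv : ∀ i : Fin 4, Tendsto
      (fun k => ((p' k i).1 : ℂ) * δ' k + ((p' k i).2 : ℂ) * δ' k * Complex.I) atTop (𝓝 (D.pt i)) := by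
    intro i
    rw [hDpt i]
    exact (hpconv i).comp (tendsto_add_atTop_nat N)
  have hlim := hEng D hErect hEflat w U hUo hEsub hEU hwd hEbij hEmono δ' hδ'pos hδ'0 V' hV'mem p'
    hp'inj hp'conv hp'adm
  -- read the engine's limit through the chart algebra: normalisation `δ⁻¹`, value `C₀ K Φ_w(x)`
  obtain ⟨-, hXb, hXc⟩ := stub_chartAlgebra
  have hval := hXb w D.pt C₀ (by rw [hD1, hD0]; exact hx3) (by rw [hD1, hD2]; exact hx1)
    (by rw [hD1, hD3]; exact hx0)
  rw [hval] at hlim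
  rw [hD0, hD1, hD2, hD3] at hlim
  have hlim' : Tendsto (fun k => (δ' k)⁻¹ *
      ‖Zins (V' k) (⟨(Finset.univ.erase 1).image (p' k),
        fun x ↦ ∑ i ∈ (Finset.univ.erase 1).filter (fun i ↦ p' k i = x),
          (![1, 3, 1, 1] : Fin 4 → ℕ) i, p' k 1⟩ : LegInsertionData)‖ / ‖(ofDomain (V' k)).Z‖) atTop
      (𝓝 (C₀ * K * (‖deriv w (R.boundary τ)‖ *
        (‖w (R.boundary τ) - w (R.pt 0)‖ ^ 2 * ‖w (R.boundary τ) - w (R.pt 1)‖ ^ 2 *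
          ‖w (R.boundary τ) - w (R.pt 3)‖ ^ 2) ^ (-(1 / 3 : ℝ))))) := by
    refine (hlim.congr fun k => ?_)
    rw [hXc _ (hδ'pos k)]
  -- the bridge's `o(δ)` comparison transfers the limit to `closureDensity / δ`
  have hdiff : Tendsto (fun k => closureDensity R (δ' k) (v (k + N)) / δ' k - (δ' k)⁻¹ *
      ‖Zins (V' k) (⟨(Finset.univ.erase 1).image (p' k),
        fun x ↦ ∑ i ∈ (Finset.univ.erase 1).filter (fun i ↦ p' k i = x),
          (![1, 3, 1, 1] : Fin 4 → ℕ) i, p' k 1⟩ : LegInsertionData)‖ / ‖(ofDomain (V' k)).Z‖)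
      atTop (𝓝 0) := by
    rw [Metric.tendsto_nhds]
    intro ε hε
    have hev := (tendsto_add_atTop_nat N).eventually (hpo (ε / 2) (half_pos hε))
    filter_upwards [hev] with k hk
    rw [Real.dist_0_eq_abs]
    have hδk : 0 < δ' k := hδ'pos k
    have hrew : closureDensity R (δ' k) (v (k + N)) / δ' k - (δ' k)⁻¹ *
        ‖Zins (V' k) (⟨(Finset.univ.erase 1).image (p' k),
          fun x ↦ ∑ i ∈ (Finset.univ.erase 1).filter (fun i ↦ p' k i = x),
            (![1, 3, 1, 1] : Fin 4 → ℕ) i, p' k 1⟩ : LegInsertionData)‖ / ‖(ofDomain (V' k)).Z‖ =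
        -((‖Zins (V' k) (⟨(Finset.univ.erase 1).image (p' k),
          fun x ↦ ∑ i ∈ (Finset.univ.erase 1).filter (fun i ↦ p' k i = x),
            (![1, 3, 1, 1] : Fin 4 → ℕ) i, p' k 1⟩ : LegInsertionData)‖ / ‖(ofDomain (V' k)).Z‖ -
          closureDensity R (δ' k) (v (k + N))) / δ' k) := by
      field_simp
      ring
    rw [hrew, abs_neg, abs_div, abs_of_pos hδk, div_lt_iff₀ hδk]
    calc _ ≤ ε / 2 * δ' k := hk
      _ < ε * δ' k := by nlinarith
  have hsum := hlim'.add hdiff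
  rw [add_zero] at hsum
  rw [← tendsto_add_atTop_iff_nat N]
  refine hsum.congr fun k => ?_
  show _ = closureDensity R (δ' k) (v (k + N)) / δ' k
  ring

end Summit.CriticalPhenomena.CardyFormulaZ2.Cruxes.RectilinearCardy.ExcursionKernelCovariance

end
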